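import Literature.NumberTheory.DiophantineApproximation.RhinViolaIntegrals
import Mathlib.Data.Nat.Choose.Sum
import HarnessLib

/-!
# Viola–Zudilin's `J_z^{(0)}` as a binomial combination of Rhin–Viola's `I_z^{(0)}` (VZ 2018, Lemma 2.1, proof)

Topic `Literature/NumberTheory/DiophantineApproximation`. Everything here is PROVED (no definitions, no named
facts). Source: C. Viola, W. Zudilin, *Linear independence of dilogarithmic values*, J. reine angew. Math. 736
(2018), proof of Lemma 2.1: "Applying the binomial theorem, in two different ways, to the factor
`((1−y) + yz)^{j+q−m} = (1 + y(z−1))^{j+q−m}` in the definitions of `J_z^{(μ)}` (`μ = 0,1,2`), we obtain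
`J_z^{(μ)} = Σ_λ binom(j+q−m, λ) z^{j+k+λ} I_z^{(μ)}(h, j, k+λ, j+l+q−m−λ, m+λ)`
`= Σ_λ binom(j+q−m, λ) z^{k+m−q+λ} (z−1)^λ I_z^{(μ)}(h, j, k+λ, l, m+λ)`", with the Rhin–Viola integrals
`I_z^{(μ)}` of [RV, (2.1)–(2.3)]. This is the glue between the two vocabularies of the tree —
`ViolaZudilin.J0` (`ViolaZudilinIntegrals.lean`, parameters multiplied by `n`) and `RhinViola.I0`
(`RhinViolaIntegrals.lean`) — for the real member `μ = 0`, in the SECOND representation: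

  `J0 z π n = Σ_{λ=0}^{(j+q−m)n} binom((j+q−m)n, λ) · z^{(k+m−q)n+λ} (z−1)^λ · I0 z (hn) (jn) (kn+λ) (ln) (mn+λ)`

for `z ≥ 1` and `m ≤ j + k` (the range of all parameter sets of the paper; the tree's `base` uses the truncated
exponent `j+k−m`).

## References

* C. Viola, W. Zudilin, J. reine angew. Math. 736 (2018) 193–223, Lemma 2.1 (proof). [ViolaZudilin2018]
* G. Rhin, C. Viola, Ann. Sc. Norm. Super. Pisa Cl. Sci. (5) 4 (2005) 389–437, (2.1). [RhinViola2005]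
-/

noncomputable section

namespace Literature.NumberTheory.DiophantineApproximation

namespace ViolaZudilin

open _root_.MeasureTheory _root_.Set Finset
open RhinViola (integrand I0 integrableOn_integrand)

variable {z : ℝ}

/-- `base^n · weight` as one quotient: `N(x,y)^n (1−y+yz)^{(j+q−m)n} / (D^{(j+k−m)n} D)`. [folklore] -/
theorem base_pow_mul_weight (z : ℝ) (π : Params) (n : ℕ) (p : ℝ × ℝ) :
    base z π p ^ n * weight z p =
      (p.1 ^ π.j * (1 - p.1) ^ π.h * p.2 ^ π.k * (1 - p.2) ^ π.l) ^ n * denom₂ z p ^ ((π.j + π.q - π.m) * n) /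
        (denom₁ z p ^ ((π.j + π.k - π.m) * n) * denom₁ z p) := by
  rw [base, weight, div_pow, mul_pow, ← pow_mul, ← pow_mul]
  by_cases hD : denom₁ z p = 0
  · simp [hD]
  · field_simp

/-- The binomial expansion of the Viola–Zudilin factor: `(1 − y + yz)^N = Σ_λ binom(N,λ) (y(z−1))^λ`.
[cite: ViolaZudilin2018, Lemma 2.1 (proof)] -/
theorem denom₂_pow_eq_sum (z : ℝ) (p : ℝ × ℝ) (N : ℕ) :
    denom₂ z p ^ N = ∑ lam ∈ range (N + 1), (N.choose lam : ℝ) * (p.2 * (z - 1)) ^ lam := by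
  have h : denom₂ z p = p.2 * (z - 1) + 1 := by rw [denom₂]; ring
  rw [h, add_pow]
  refine sum_congr rfl fun lam _ => ?_
  rw [one_pow, mul_one, mul_comm]

/-- **One term of the expansion is a Rhin–Viola integrand**: for `m ≤ j+k`,
`N(x,y)^n · (y(z−1))^λ / (D^{(j+k−m)n} D) = (z−1)^λ · integrand z (hn) (jn) (kn+λ) (ln) (mn+λ) (x,y)`
(both sides vanish where `D = 0`). [cite: ViolaZudilin2018, Lemma 2.1 (proof)] -/
theorem term_eq_integrand (z : ℝ) (π : Params) (hm : π.m ≤ π.j + π.k) (n lam : ℕ) (p : ℝ × ℝ) :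
    (p.1 ^ π.j * (1 - p.1) ^ π.h * p.2 ^ π.k * (1 - p.2) ^ π.l) ^ n * (p.2 * (z - 1)) ^ lam /
        (denom₁ z p ^ ((π.j + π.k - π.m) * n) * denom₁ z p) =
      (z - 1) ^ lam * integrand z (π.h * n) (π.j * n) (π.k * n + lam) (π.l * n) (π.m * n + lam) p := by
  unfold integrand
  by_cases hD : denom₁ z p = 0
  · simp [hD]
  · have hexp : π.j * n + (π.k * n + lam) + 1 = (π.m * n + lam) + ((π.j + π.k - π.m) * n + 1) := by
      have h1 : (π.j + π.k - π.m) * n + π.m * n = (π.j + π.k) * n := by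
        rw [← Nat.add_mul, Nat.sub_add_cancel hm]
      have h2 : (π.j + π.k) * n = π.j * n + π.k * n := Nat.add_mul _ _ _
      omega
    rw [hexp, show denom₁ z p ^ (π.m * n + lam + ((π.j + π.k - π.m) * n + 1)) =
        denom₁ z p ^ (π.m * n + lam) * (denom₁ z p ^ ((π.j + π.k - π.m) * n) * denom₁ z p) by ring,
      mul_pow p.2 (z - 1) lam]
    field_simp
    ring

/-- **Pointwise form of VZ Lemma 2.1 (second representation), `μ = 0`**: for `m ≤ j+k`,
`base^n · weight = Σ_{λ=0}^{(j+q−m)n} binom((j+q−m)n, λ) (z−1)^λ · integrand z (hn)(jn)(kn+λ)(ln)(mn+λ)`.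
[cite: ViolaZudilin2018, Lemma 2.1 (proof)] -/
theorem base_pow_mul_weight_eq_sum (z : ℝ) (π : Params) (hm : π.m ≤ π.j + π.k) (n : ℕ) (p : ℝ × ℝ) :
    base z π p ^ n * weight z p =
      ∑ lam ∈ range ((π.j + π.q - π.m) * n + 1), (((π.j + π.q - π.m) * n).choose lam : ℝ) * (z - 1) ^ lam *
        integrand z (π.h * n) (π.j * n) (π.k * n + lam) (π.l * n) (π.m * n + lam) p := by
  rw [base_pow_mul_weight, denom₂_pow_eq_sum, mul_sum, sum_div]
  refine sum_congr rfl fun lam _ => ?_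
  set Nxy := p.1 ^ π.j * (1 - p.1) ^ π.h * p.2 ^ π.k * (1 - p.2) ^ π.l with hNxy
  set C : ℝ := (((π.j + π.q - π.m) * n).choose lam : ℝ) with hC
  calc Nxy ^ n * (C * (p.2 * (z - 1)) ^ lam) / (denom₁ z p ^ ((π.j + π.k - π.m) * n) * denom₁ z p)
      = C * (Nxy ^ n * (p.2 * (z - 1)) ^ lam / (denom₁ z p ^ ((π.j + π.k - π.m) * n) * denom₁ z p)) := by
        ring
    _ = C * ((z - 1) ^ lam *
          integrand z (π.h * n) (π.j * n) (π.k * n + lam) (π.l * n) (π.m * n + lam) p) := by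
        rw [hNxy, term_eq_integrand z π hm n lam p]
    _ = _ := by ring

/-- **Viola–Zudilin 2018, Lemma 2.1 (proof), second representation, real member `μ = 0`**: for `z ≥ 1` and
`m ≤ j + k`,
`J0 z π n = Σ_{λ=0}^{(j+q−m)n} binom((j+q−m)n, λ) · z^{(k+m−q)n+λ} (z−1)^λ · I0 z (hn) (jn) (kn+λ) (ln) (mn+λ)`
(termwise integration of `base_pow_mul_weight_eq_sum`; the powers of `z` combine as
`z^{(k−l−q)n} · z^{ln+mn+λ} = z^{(k+m−q)n+λ}`). [cite: ViolaZudilin2018, Lemma 2.1 (proof)] -/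
theorem J0_eq_sum_I0 (hz : 1 ≤ z) (π : Params) (hm : π.m ≤ π.j + π.k) (n : ℕ) :
    J0 z π n =
      ∑ lam ∈ range ((π.j + π.q - π.m) * n + 1), (((π.j + π.q - π.m) * n).choose lam : ℝ) *
        z ^ (((π.k : ℤ) + π.m - π.q) * n + lam) * (z - 1) ^ lam *
          I0 z (π.h * n) (π.j * n) (π.k * n + lam) (π.l * n) (π.m * n + lam) := by
  have hz0 : z ≠ 0 := by positivity
  set N := (π.j + π.q - π.m) * n with hN
  -- termwise integration
  have hint : ∫ p in unitSquare, base z π p ^ n * weight z p =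
      ∑ lam ∈ range (N + 1), (N.choose lam : ℝ) * (z - 1) ^ lam *
        ∫ p in unitSquare, integrand z (π.h * n) (π.j * n) (π.k * n + lam) (π.l * n) (π.m * n + lam) p := by
    rw [setIntegral_congr_fun measurableSet_unitSquare
      (fun p _ => base_pow_mul_weight_eq_sum z π hm n p), integral_finsetSum]
    · refine sum_congr rfl fun lam _ => ?_
      rw [← integral_const_mul]
    · intro lam _
      exact (integrableOn_integrand hz _ _ _ _ _).const_mul _
  -- the integrals in terms of `I0`
  have hI : ∀ lam : ℕ,
      ∫ p in unitSquare, integrand z (π.h * n) (π.j * n) (π.k * n + lam) (π.l * n) (π.m * n + lam) p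
      = z ^ (((π.l * n : ℕ) : ℤ) + ((π.m * n + lam : ℕ) : ℤ)) *
          I0 z (π.h * n) (π.j * n) (π.k * n + lam) (π.l * n) (π.m * n + lam) := by
    intro lam
    rw [I0, ← mul_assoc, ← zpow_add₀ hz0, add_neg_cancel, zpow_zero, one_mul]
  rw [J0, hint, mul_sum]
  refine sum_congr rfl fun lam _ => ?_
  have hexp : ((π.k : ℤ) - π.l - π.q) * n + (((π.l * n : ℕ) : ℤ) + ((π.m * n + lam : ℕ) : ℤ)) =
      ((π.k : ℤ) + π.m - π.q) * n + lam := by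
    push_cast
    ring
  have hz2 : z ^ (((π.k : ℤ) - π.l - π.q) * n) * z ^ (((π.l * n : ℕ) : ℤ) + ((π.m * n + lam : ℕ) : ℤ)) =
      z ^ (((π.k : ℤ) + π.m - π.q) * n + lam) := by
    rw [← zpow_add₀ hz0, hexp]
  rw [hI lam, ← hz2]
  ring

end ViolaZudilin

end Literature.NumberTheory.DiophantineApproximation

end
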